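/-
Copyright (c) 2026 the pub-hodgecm-mathlib formalisation cell (harness21).  Prover seat hodgecm-mathlib-K2Liu-p10 (g4), Track B «K2-LIT»,
#184♮ = hLiu418 = `stmt-HodgeConjecture-24832`; organ S2 «ARCH SPAN BY K-TYPE PATHS», file S2-K K-1b (LEAD F0P6-plan (g14) RULING M-158f, BATCH #10 (3) GO;
DESIGN-S2 41bd43fff4457fcc §3 (i) «each `W_λ` is stable under the algebraic `𝔨_ℂ = 𝔤𝔩₂ ⊕ 𝔤𝔩₂` action»; ref1 TESTVECTORS-S2T (K-i)).  KERNEL: theorems only.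
-/
import Summits.HodgeConjecture.HodgeConjecture.Theorems.K2LiuU22KTypeMembership   -- ★ K-1 p860138 (polarisation `mem_of_forall_linPow_mul_lin_mem`; brings the DEFS leaf)
import HarnessLib

/-!
# Crux `HLiu418`, organ S2, file S2-K K-1b: THE `𝔨_ℂ = 𝔤𝔩₂ ⊕ 𝔤𝔩₂` VECTOR FIELDS ON `ℂ[u, D⁻¹]` — Leibniz rules, values on the coordinates, on `det`, `D⁻¹`, on the
# rank-one forms `ξ·u·η`, and STABILITY OF EVERY K-TYPE `W_{(k+l,l)}` under `R_{ab}`, `L_{ab}`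

Cell `hodgecm-mathlib`, crux item hLiu418 = `stmt-HodgeConjecture-24832`, route of record `HCCMUnconditional`; squad K2 ∕ K2Liu, prover K2Liu-p10 (g4).
THEOREMS ONLY (no `def`, no `instance`, no notation, no named-fact hypothesis, no `sorry`); lane `--supports stmt-HodgeConjecture-24832 --as helper`.

* §1 GENERIC (`(R, d, u, Dinv)` with the interface `hd : d i j (u k l) = δ`, `hD : det u · Dinv = 1` of the DEFS leaf — the letters S2-T types against): the operators
  `R_{ab} = Σ_k u_{ka}∂_{kb}` (★ `rOp`) and `L_{ab} = Σ_k u_{bk}∂_{ak}` (★ `lOp`) are DERIVATIONS (`rOp_mul`, `rOp_pow`, `lOp_mul`, `lOp_pow`) with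
  `rOp_u : R_{ab} u_{ij} = δ_{jb} u_{ia}`, `lOp_u : L_{ab} u_{ij} = δ_{ia} u_{bj}`, **`rOp_det : R_{ab}(det u) = δ_{ab} det u`**, `lOp_det`, `rOp_Dinv : R_{ab} D⁻¹ = −δ_{ab} D⁻¹`, `lOp_Dinv`,
  and on the rank-one forms **`rOp_bil : R_{ab}(ξ·u·η) = η_b · (ξ·u·e_a)`**, **`lOp_bil : L_{ab}(ξ·u·η) = ξ_a · (e_b·u·η)`** [KashiwaraVergne1978, §II.5].
* §2 THE CARRIER: `rOp_dz : R_{ab} D^l = l δ_{ab} D^l`, `lOp_dz`, the two polarised memberships `dz_mul_bil_pow_mul_bil_mem_right∕_left`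
  (`D^l (ξuη)^k (ξuζ)`, `D^l (ξuη)^k (ζuη) ∈ W_{(k+1+l,l)}`), and **STABILITY `rOp_mem_kType`, `lOp_mem_kType`**: `R_{ab} W_{(k+l,l)} ⊆ W_{(k+l,l)}`, `L_{ab} W ⊆ W`
  — hence under `euler`, `casimir` and every polynomial in the `𝔨_ℂ` fields (`euler_mem_kType`, `casimir_mem_kType`).
NOT here (K-2): the eigenvalues of `E`, `C` on `W`, the decomposition `⨁ W = ⊤` and the structure lemma.

HONEST LABEL: HC_CM is proved only modulo the 7 printed citations (2 remaining named inputs: hLiu418 = stmt-HodgeConjecture-24832, h413 = stmt-HodgeConjecture-24833)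
until rung 0 closes; helper, closes no item.
References: [KashiwaraVergne1978] M. Kashiwara, M. Vergne, Invent. Math. 44 (1978) §II.5 (`GL × GL` action on polynomial functions of matrices by vector fields);
[LeeZhu1998] S. T. Lee, C.-B. Zhu, Trans. AMS 350 (1998) p. 5032; [Howe1989Remarks] R. Howe, Trans. AMS 313 (1989) §2.
-/

set_option autoImplicit false
set_option linter.dupNamespace false -- the mandated namespace repeats `HodgeConjecture.HodgeConjecture`

noncomputable section

open Matrix
open Summit.HodgeConjecture.HodgeConjecture.Cruxes.HLiu418.K2LiuU22CompactPictureDefs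
open Summit.HodgeConjecture.HodgeConjecture.Cruxes.HLiu418.K2LiuU22KTypeMembership

namespace Summit.HodgeConjecture.HodgeConjecture.Cruxes.HLiu418.K2LiuU22KTypeStability

/-! ## §1 Generic: the right and left `𝔤𝔩₂` fields are derivations; their values on `u`, `det u`, `D⁻¹`, `ξ·u·η` -/

section Generic

variable {R : Type*} [CommRing R] [Algebra ℂ R] (d : Fin 2 → Fin 2 → Derivation ℂ R R) (u : Matrix (Fin 2) (Fin 2) R) (Dinv : R)

/-- Leibniz rule for `R_{ab}`. [cite: KashiwaraVergne1978, §II.5] -/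
theorem rOp_mul (a b : Fin 2) (x y : R) : rOp d u a b (x * y) = x * rOp d u a b y + y * rOp d u a b x := by
  simp only [rOp_apply, Derivation.leibniz, smul_eq_mul, mul_add, Finset.sum_add_distrib, Finset.mul_sum]
  congr 1 <;> exact Finset.sum_congr rfl fun k _ => by ring

/-- Leibniz rule for `L_{ab}`. [cite: KashiwaraVergne1978, §II.5] -/
theorem lOp_mul (a b : Fin 2) (x y : R) : lOp d u a b (x * y) = x * lOp d u a b y + y * lOp d u a b x := by
  simp only [lOp_apply, Derivation.leibniz, smul_eq_mul, mul_add, Finset.sum_add_distrib, Finset.mul_sum]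
  congr 1 <;> exact Finset.sum_congr rfl fun k _ => by ring

/-- `R_{ab} 1 = 0`. [folklore] -/
theorem rOp_one (a b : Fin 2) : rOp d u a b 1 = 0 := by
  simp [rOp_apply, Derivation.map_one_eq_zero]

/-- `L_{ab} 1 = 0`. [folklore] -/
theorem lOp_one (a b : Fin 2) : lOp d u a b 1 = 0 := by
  simp [lOp_apply, Derivation.map_one_eq_zero]

/-- power rule for `R_{ab}`: `R(x^n) = n x^{n−1} R(x)`. [folklore] -/
theorem rOp_pow (a b : Fin 2) (x : R) (n : ℕ) : rOp d u a b (x ^ n) = (n : R) * x ^ (n - 1) * rOp d u a b x := by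
  induction n with
  | zero => rw [pow_zero, rOp_one, Nat.cast_zero, zero_mul, zero_mul]
  | succ n ih =>
    rw [pow_succ, rOp_mul, ih, Nat.add_sub_cancel, Nat.cast_succ]
    rcases n with _ | n
    · simp
    · rw [Nat.add_sub_cancel, pow_succ]
      ring

/-- power rule for `L_{ab}`. [folklore] -/
theorem lOp_pow (a b : Fin 2) (x : R) (n : ℕ) : lOp d u a b (x ^ n) = (n : R) * x ^ (n - 1) * lOp d u a b x := by
  induction n with
  | zero => rw [pow_zero, lOp_one, Nat.cast_zero, zero_mul, zero_mul]
  | succ n ih =>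
    rw [pow_succ, lOp_mul, ih, Nat.add_sub_cancel, Nat.cast_succ]
    rcases n with _ | n
    · simp
    · rw [Nat.add_sub_cancel, pow_succ]
      ring

variable (hd : ∀ i j k l : Fin 2, d i j (u k l) = if i = k ∧ j = l then 1 else 0)
include hd

/-- **`R_{ab} u_{ij} = δ_{jb} u_{ia}`** (right translation moves column `b` to column `a`). [cite: KashiwaraVergne1978, §II.5] -/
theorem rOp_u (a b i j : Fin 2) : rOp d u a b (u i j) = if j = b then u i a else 0 := by
  rw [rOp_apply, Finset.sum_eq_single i (fun k _ hk => by rw [hd, if_neg (fun h => hk h.1), mul_zero]) (fun h => absurd (Finset.mem_univ i) h), hd]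
  by_cases hjb : j = b
  · subst hjb; simp
  · rw [if_neg (fun h => hjb h.2.symm), if_neg hjb, mul_zero]

/-- **`L_{ab} u_{ij} = δ_{ia} u_{bj}`** (left translation moves row `a` to row `b`). [cite: KashiwaraVergne1978, §II.5] -/
theorem lOp_u (a b i j : Fin 2) : lOp d u a b (u i j) = if i = a then u b j else 0 := by
  rw [lOp_apply, Finset.sum_eq_single j (fun k _ hk => by rw [hd, if_neg (fun h => hk h.2), mul_zero]) (fun h => absurd (Finset.mem_univ j) h), hd]
  by_cases hia : i = a
  · subst hia; simp
  · rw [if_neg (fun h => hia h.1.symm), if_neg hia, mul_zero]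

/-- **`R_{ab}(det u) = δ_{ab} det u`** (`det` is a character of the right `GL₂`). [cite: KashiwaraVergne1978, §II.5] -/
theorem rOp_det (a b : Fin 2) : rOp d u a b u.det = if a = b then u.det else 0 := by
  rw [Matrix.det_fin_two, map_sub, rOp_mul, rOp_mul, rOp_u d u hd, rOp_u d u hd, rOp_u d u hd, rOp_u d u hd]
  fin_cases a <;> fin_cases b <;> simp <;> ring

/-- **`L_{ab}(det u) = δ_{ab} det u`**. [cite: KashiwaraVergne1978, §II.5] -/
theorem lOp_det (a b : Fin 2) : lOp d u a b u.det = if a = b then u.det else 0 := by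
  rw [Matrix.det_fin_two, map_sub, lOp_mul, lOp_mul, lOp_u d u hd, lOp_u d u hd, lOp_u d u hd, lOp_u d u hd]
  fin_cases a <;> fin_cases b <;> simp <;> ring

/-- `R_{ab} D⁻¹ = −δ_{ab} D⁻¹`. [folklore] -/
theorem rOp_Dinv (hD : u.det * Dinv = 1) (a b : Fin 2) : rOp d u a b Dinv = -(if a = b then Dinv else 0) := by
  have h := congrArg (rOp d u a b) hD
  rw [rOp_mul, rOp_one, rOp_det d u hd] at h
  have h2 : rOp d u a b Dinv = Dinv * (u.det * rOp d u a b Dinv) := by rw [← mul_assoc, mul_comm Dinv, hD, one_mul]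
  rw [h2, eq_neg_of_add_eq_zero_left h]
  split_ifs
  · rw [mul_comm Dinv u.det, hD, mul_neg, mul_one]
  · simp

/-- `L_{ab} D⁻¹ = −δ_{ab} D⁻¹`. [folklore] -/
theorem lOp_Dinv (hD : u.det * Dinv = 1) (a b : Fin 2) : lOp d u a b Dinv = -(if a = b then Dinv else 0) := by
  have h := congrArg (lOp d u a b) hD
  rw [lOp_mul, lOp_one, lOp_det d u hd] at h
  have h2 : lOp d u a b Dinv = Dinv * (u.det * lOp d u a b Dinv) := by rw [← mul_assoc, mul_comm Dinv, hD, one_mul]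
  rw [h2, eq_neg_of_add_eq_zero_left h]
  split_ifs
  · rw [mul_comm Dinv u.det, hD, mul_neg, mul_one]
  · simp

/-- **`R_{ab}(ξ·u·η) = η_b · (ξ·u·e_a)`**. [cite: KashiwaraVergne1978, §II.5] -/
theorem rOp_bil (a b : Fin 2) (ξ η : Fin 2 → ℂ) : rOp d u a b (bil u ξ η) = η b • bil u ξ (Pi.single a 1) := by
  simp only [bil, map_sum, map_smul, rOp_u d u hd, smul_ite, smul_zero, Finset.sum_ite_eq', Finset.mem_univ, if_true, Pi.single_apply, mul_ite, mul_one,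
    mul_zero, ite_smul, zero_smul, Finset.smul_sum, smul_smul]
  refine Finset.sum_congr rfl fun i _ => ?_
  rw [mul_comm (η b)]

/-- **`L_{ab}(ξ·u·η) = ξ_a · (e_b·u·η)`**. [cite: KashiwaraVergne1978, §II.5] -/
theorem lOp_bil (a b : Fin 2) (ξ η : Fin 2 → ℂ) : lOp d u a b (bil u ξ η) = ξ a • bil u (Pi.single b 1) η := by
  simp only [bil, map_sum, map_smul, lOp_u d u hd, smul_ite, smul_zero, Pi.single_apply, ite_mul, one_mul, zero_mul, ite_smul, zero_smul, Finset.smul_sum,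
    smul_smul]
  rw [Finset.sum_comm]
  simp only [Finset.sum_ite_eq', Finset.mem_univ, if_true]
  rw [Finset.sum_comm]
  refine Finset.sum_congr rfl fun j _ => ?_
  rw [Finset.sum_ite_eq', if_pos (Finset.mem_univ _)]

end Generic

/-! ## §2 The carrier: `R_{ab} D^l`, polarised memberships, stability of `W_{(k+l,l)}` -/

section CarrierFacts

/-- `R_{ab} D^l = l δ_{ab} D^l` (`l ∈ ℤ`). [cite: KashiwaraVergne1978, §II.5] -/
theorem rOp_dz (a b : Fin 2) (l : ℤ) : rOp pd uMat a b (dz l) = if a = b then (l : ℂ) • dz l else 0 := by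
  rcases Int.eq_nat_or_neg l with ⟨n, rfl | rfl⟩
  · rw [dz_natCast, rOp_pow, rOp_det pd uMat pd_uMat]
    split_ifs
    · rcases n with _ | n
      · simp
      · rw [Nat.add_sub_cancel, Int.cast_natCast, Nat.cast_smul_eq_nsmul ℂ, nsmul_eq_mul, pow_succ]; ring
    · rw [mul_zero]
  · rw [dz_neg_natCast, rOp_pow, rOp_Dinv pd uMat dInv pd_uMat det_uMat_mul_dInv]
    split_ifs
    · rcases n with _ | n
      · simp
      · rw [Nat.add_sub_cancel, Int.cast_neg, Int.cast_natCast, neg_smul, Nat.cast_smul_eq_nsmul ℂ, nsmul_eq_mul, pow_succ]; ring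
    · rw [neg_zero, mul_zero]

/-- `L_{ab} D^l = l δ_{ab} D^l`. [cite: KashiwaraVergne1978, §II.5] -/
theorem lOp_dz (a b : Fin 2) (l : ℤ) : lOp pd uMat a b (dz l) = if a = b then (l : ℂ) • dz l else 0 := by
  rcases Int.eq_nat_or_neg l with ⟨n, rfl | rfl⟩
  · rw [dz_natCast, lOp_pow, lOp_det pd uMat pd_uMat]
    split_ifs
    · rcases n with _ | n
      · simp
      · rw [Nat.add_sub_cancel, Int.cast_natCast, Nat.cast_smul_eq_nsmul ℂ, nsmul_eq_mul, pow_succ]; ring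
    · rw [mul_zero]
  · rw [dz_neg_natCast, lOp_pow, lOp_Dinv pd uMat dInv pd_uMat det_uMat_mul_dInv]
    split_ifs
    · rcases n with _ | n
      · simp
      · rw [Nat.add_sub_cancel, Int.cast_neg, Int.cast_natCast, neg_smul, Nat.cast_smul_eq_nsmul ℂ, nsmul_eq_mul, pow_succ]; ring
    · rw [neg_zero, mul_zero]

/-- linearity of the rank-one form in `η` along a line: `ξ·u·(η + c ζ) = ξ·u·η + c (ξ·u·ζ)`. [folklore] -/
theorem bil_add_smul_right {R : Type*} [CommRing R] [Algebra ℂ R] (u : Matrix (Fin 2) (Fin 2) R) (ξ η ζ : Fin 2 → ℂ) (c : ℂ) :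
    bil u ξ (η + c • ζ) = bil u ξ η + c • bil u ξ ζ := by
  simp only [bil, Pi.add_apply, Pi.smul_apply, smul_eq_mul, mul_add, add_smul, Finset.sum_add_distrib, Finset.smul_sum, smul_smul]
  congr 1
  refine Finset.sum_congr rfl fun i _ => Finset.sum_congr rfl fun j _ => ?_
  ring_nf

/-- linearity of the rank-one form in `ξ` along a line. [folklore] -/
theorem bil_add_smul_left {R : Type*} [CommRing R] [Algebra ℂ R] (u : Matrix (Fin 2) (Fin 2) R) (ξ ζ η : Fin 2 → ℂ) (c : ℂ) :
    bil u (ξ + c • ζ) η = bil u ξ η + c • bil u ζ η := by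
  simp only [bil, Pi.add_apply, Pi.smul_apply, smul_eq_mul, add_mul, add_smul, Finset.sum_add_distrib, Finset.smul_sum, smul_smul]
  congr 1
  refine Finset.sum_congr rfl fun i _ => Finset.sum_congr rfl fun j _ => ?_
  ring_nf

/-- **right polarised membership**: `D^l (ξuη)^k (ξuζ) ∈ W_{(k+1+l, l)}` (the `c¹`-coefficient of `D^l (ξu(η + cζ))^{k+1}`, divided by `k+1`). [cite: KashiwaraVergne1978, §II.5] -/
theorem dz_mul_bil_pow_mul_bil_mem_right (k : ℕ) (l : ℤ) (ξ η ζ : Fin 2 → ℂ) : dz l * bil uMat ξ η ^ k * bil uMat ξ ζ ∈ kType (k + 1) l := by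
  have h := (mem_of_forall_linPow_mul_lin_mem (kType (k + 1) l) (dz l) (bil uMat ξ η) (bil uMat ξ ζ) 1 0 (k + 1) fun c => by
    rw [smul_zero, add_zero, mul_one, ← bil_add_smul_right]; exact dz_mul_bil_pow_mem_kType (k + 1) l ξ _).2
  rw [Nat.add_sub_cancel, mul_one, mul_zero, add_zero, Nat.cast_add, Nat.cast_one] at h
  have hk : ((k : ℂ) + 1) ≠ 0 := by exact_mod_cast Nat.succ_ne_zero k
  have e1 : ((k : Carrier) + 1) = algebraMap ℂ Carrier ((k : ℂ) + 1) := by rw [map_add, map_natCast, map_one]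
  have e : dz l * (((k : Carrier) + 1) * bil uMat ξ η ^ k * bil uMat ξ ζ) = ((k : ℂ) + 1) • (dz l * bil uMat ξ η ^ k * bil uMat ξ ζ) := by
    rw [e1, mul_assoc (algebraMap ℂ Carrier _), ← Algebra.smul_def, mul_smul_comm, ← mul_assoc]
  rw [e] at h
  have h2 := (kType (k + 1) l).smul_mem (((k : ℂ) + 1)⁻¹) h
  rwa [inv_smul_smul₀ hk] at h2

/-- **left polarised membership**: `D^l (ξuη)^k (ζuη) ∈ W_{(k+1+l, l)}`. [cite: KashiwaraVergne1978, §II.5] -/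
theorem dz_mul_bil_pow_mul_bil_mem_left (k : ℕ) (l : ℤ) (ξ ζ η : Fin 2 → ℂ) : dz l * bil uMat ξ η ^ k * bil uMat ζ η ∈ kType (k + 1) l := by
  have h := (mem_of_forall_linPow_mul_lin_mem (kType (k + 1) l) (dz l) (bil uMat ξ η) (bil uMat ζ η) 1 0 (k + 1) fun c => by
    rw [smul_zero, add_zero, mul_one, ← bil_add_smul_left]; exact dz_mul_bil_pow_mem_kType (k + 1) l _ η).2
  rw [Nat.add_sub_cancel, mul_one, mul_zero, add_zero, Nat.cast_add, Nat.cast_one] at h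
  have hk : ((k : ℂ) + 1) ≠ 0 := by exact_mod_cast Nat.succ_ne_zero k
  have e1 : ((k : Carrier) + 1) = algebraMap ℂ Carrier ((k : ℂ) + 1) := by rw [map_add, map_natCast, map_one]
  have e : dz l * (((k : Carrier) + 1) * bil uMat ξ η ^ k * bil uMat ζ η) = ((k : ℂ) + 1) • (dz l * bil uMat ξ η ^ k * bil uMat ζ η) := by
    rw [e1, mul_assoc (algebraMap ℂ Carrier _), ← Algebra.smul_def, mul_smul_comm, ← mul_assoc]
  rw [e] at h
  have h2 := (kType (k + 1) l).smul_mem (((k : ℂ) + 1)⁻¹) h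
  rwa [inv_smul_smul₀ hk] at h2

/-- **`R_{ab}` on a generator**: `R_{ab}(D^l (ξuη)^k) = l δ_{ab} D^l (ξuη)^k + k η_b D^l (ξuη)^{k−1} (ξue_a)`. [cite: KashiwaraVergne1978, §II.5] -/
theorem rOp_dz_mul_bil_pow (a b : Fin 2) (k : ℕ) (l : ℤ) (ξ η : Fin 2 → ℂ) :
    rOp pd uMat a b (dz l * bil uMat ξ η ^ k) =
      (if a = b then (l : ℂ) • (dz l * bil uMat ξ η ^ k) else 0) + ((k : ℂ) * η b) • (dz l * bil uMat ξ η ^ (k - 1) * bil uMat ξ (Pi.single a 1)) := by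
  rw [rOp_mul, rOp_pow, rOp_bil pd uMat pd_uMat, rOp_dz]
  split_ifs <;> simp only [Algebra.smul_def, map_mul, map_natCast, mul_zero, add_zero, zero_add] <;> ring

/-- **`L_{ab}` on a generator**: `L_{ab}(D^l (ξuη)^k) = l δ_{ab} D^l (ξuη)^k + k ξ_a D^l (ξuη)^{k−1} (e_b u η)`. [cite: KashiwaraVergne1978, §II.5] -/
theorem lOp_dz_mul_bil_pow (a b : Fin 2) (k : ℕ) (l : ℤ) (ξ η : Fin 2 → ℂ) :
    lOp pd uMat a b (dz l * bil uMat ξ η ^ k) =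
      (if a = b then (l : ℂ) • (dz l * bil uMat ξ η ^ k) else 0) + ((k : ℂ) * ξ a) • (dz l * bil uMat ξ η ^ (k - 1) * bil uMat (Pi.single b 1) η) := by
  rw [lOp_mul, lOp_pow, lOp_bil pd uMat pd_uMat, lOp_dz]
  split_ifs <;> simp only [Algebra.smul_def, map_mul, map_natCast, mul_zero, add_zero, zero_add] <;> ring

/-- `E = Σ_a R_{aa}`. [cite: KashiwaraVergne1978, §II.5] -/
theorem euler_eq_sum_rOp {R : Type*} [CommRing R] [Algebra ℂ R] (d : Fin 2 → Fin 2 → Derivation ℂ R R) (u : Matrix (Fin 2) (Fin 2) R) (F : R) :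
    euler d u F = ∑ a : Fin 2, rOp d u a a F := by
  rw [euler_apply, Finset.sum_comm]
  simp only [rOp_apply]

/-- **STABILITY OF THE K-TYPES UNDER THE RIGHT `𝔤𝔩₂` FIELDS**: `R_{ab} W_{(k+l,l)} ⊆ W_{(k+l,l)}`. [cite: KashiwaraVergne1978, §II.5] [cite: LeeZhu1998, p. 5032] -/
theorem rOp_mem_kType (a b : Fin 2) (k : ℕ) (l : ℤ) {f : Carrier} (hf : f ∈ kType k l) : rOp pd uMat a b f ∈ kType k l := by
  have hle : kType k l ≤ (kType k l).comap (rOp pd uMat a b) := by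
    refine Submodule.span_le.2 ?_
    rintro _ ⟨ξ, η, rfl⟩
    show rOp pd uMat a b (dz l * bil uMat ξ η ^ k) ∈ kType k l
    rw [rOp_dz_mul_bil_pow]
    refine (kType k l).add_mem ?_ ?_
    · split_ifs
      · exact (kType k l).smul_mem _ (dz_mul_bil_pow_mem_kType k l ξ η)
      · exact (kType k l).zero_mem
    · rcases Nat.eq_zero_or_pos k with rfl | hk
      · rw [Nat.cast_zero, zero_mul, zero_smul]
        exact (kType 0 l).zero_mem
      · refine (kType k l).smul_mem _ ?_
        have h := dz_mul_bil_pow_mul_bil_mem_right (k - 1) l ξ η (Pi.single a 1)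
        rwa [Nat.sub_add_cancel hk] at h
  exact hle hf

/-- **STABILITY OF THE K-TYPES UNDER THE LEFT `𝔤𝔩₂` FIELDS**: `L_{ab} W_{(k+l,l)} ⊆ W_{(k+l,l)}`. [cite: KashiwaraVergne1978, §II.5] [cite: LeeZhu1998, p. 5032] -/
theorem lOp_mem_kType (a b : Fin 2) (k : ℕ) (l : ℤ) {f : Carrier} (hf : f ∈ kType k l) : lOp pd uMat a b f ∈ kType k l := by
  have hle : kType k l ≤ (kType k l).comap (lOp pd uMat a b) := by
    refine Submodule.span_le.2 ?_
    rintro _ ⟨ξ, η, rfl⟩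
    show lOp pd uMat a b (dz l * bil uMat ξ η ^ k) ∈ kType k l
    rw [lOp_dz_mul_bil_pow]
    refine (kType k l).add_mem ?_ ?_
    · split_ifs
      · exact (kType k l).smul_mem _ (dz_mul_bil_pow_mem_kType k l ξ η)
      · exact (kType k l).zero_mem
    · rcases Nat.eq_zero_or_pos k with rfl | hk
      · rw [Nat.cast_zero, zero_mul, zero_smul]
        exact (kType 0 l).zero_mem
      · refine (kType k l).smul_mem _ ?_
        have h := dz_mul_bil_pow_mul_bil_mem_left (k - 1) l ξ (Pi.single b 1) η
        rwa [Nat.sub_add_cancel hk] at h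
  exact hle hf

/-- stability under the Euler operator. [cite: KashiwaraVergne1978, §II.5] -/
theorem euler_mem_kType (k : ℕ) (l : ℤ) {f : Carrier} (hf : f ∈ kType k l) : euler pd uMat f ∈ kType k l := by
  rw [euler_eq_sum_rOp]
  exact (kType k l).sum_mem fun a _ => rOp_mem_kType a a k l hf

/-- stability under the right Casimir. [cite: LeeZhu1998, p. 5032] -/
theorem casimir_mem_kType (k : ℕ) (l : ℤ) {f : Carrier} (hf : f ∈ kType k l) : casimir pd uMat f ∈ kType k l := by
  rw [casimir_apply]
  exact (kType k l).sum_mem fun a _ => (kType k l).sum_mem fun b _ => rOp_mem_kType a b k l (rOp_mem_kType b a k l hf)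

end CarrierFacts

end Summit.HodgeConjecture.HodgeConjecture.Cruxes.HLiu418.K2LiuU22KTypeStability

end
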